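import Literature.Analysis.SpecialFunctions.HypergeometricPolynomial
import Literature.Probability.RandomPlanarGeometry.RadialBesselODE
import HarnessLib

/-!
# Eigenfunctions of the radial Bessel generator with LSW's boundary behaviour

Topic `Literature/Probability/Percolation`; family `crit-perc`. Pure real analysis, part of the
analytic half of the discharge of the named fact
`Literature.Probability.Percolation.LawlerSchrammWerner2002_hittingPDE` (`OneArmHittingPDE.lean`;
Lawler–Schramm–Werner, *One-arm exponent for critical 2D percolation*, Electron. J. Probab. 7
(2002), paper no. 2, Lemma 2.2 and (2.4)). LSW's function `h(θ, t) = P[𝔯(θ) ≤ e^{-t}]` solves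
`∂ₜ h = Λ h`, `Λ = (κ/2) ∂²_θ + cot(θ/2) ∂_θ` (the generator of the radial Bessel process
(2.11)), vanishes at `θ = 0` ((2.3)) and is reflected at `θ = 2π` ((2.12)); its comparison
function `H(θ, t) = sin(θ/4)^q e^{-λt}` (p. 7; the tree's `lswH`, `lswEigen`) is the ground
state of this boundary problem. Here we give the WHOLE spectrum explicitly, for every `κ > 4`.

**The Dirichlet-branch lift.** For a function `Q` of `z ∈ [0, 1]` put
`(L Q)(θ) = sin(θ/4)^q · Q(sin²(θ/4))`, `q = (κ - 4)/κ`. A direct computation (`lswOp_lswLift`)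
shows that `Λ (L Q) = L (M Q)` with
`M Q = (κ/8) [z(1-z) Q'' + (c - 2z) Q'] - λ Q`, `c = 3/2 - 2/κ`, `λ = (κ² - 16)/(32κ)`
(LSW (1.1)), i.e. `z = sin²(θ/4)` conjugates `Λ` (restricted to the Dirichlet branch at `0`,
which `sin(θ/4)^q` carries) to Euler's hypergeometric operator with `a + b = 1` (AAR (2.3.5)).
Every lift vanishes at `θ = 0`, is even about `θ = 2π` and has `(L Q)'(2π) = 0`.

**The eigenfunctions.** With the hypergeometric polynomials `y_n = ₂F₁(-n, n+1; c; ·)` of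
`Literature/Analysis/SpecialFunctions/HypergeometricPolynomial.lean` (`M y_n = -λ_n y_n`),

  `φ_n = L y_n`,  `Λ φ_n = -λ_n φ_n` on `(0, 2π)`,  `λ_n = λ + (κ/8) n (n+1)`,

so `e^{-λ_n t} φ_n(θ)` solves LSW's PDE (2.4), `φ_n(0) = 0`, `φ_n'(2π) = 0`; `n = 0` recovers
`lswH`/`lswEigen`. These are the separated solutions from which the solution
`u = L(Σ c_n e^{-λ_n t} y_n)` of LSW's boundary problem with `u(·, 0) = 1` is built in the
sequel files (the lift lemmas are stated for general `Q` for that purpose). No named fact is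
introduced.

## Contents

* `lswJacobiParam κ = 3/2 - 2/κ`, `lswEigenvalue κ n = lswLambda κ + (κ/8) n (n+1)`;
* `lswLift κ Q`, `lswLiftD`, `lswLiftDD`, `lswLiftT` with `hasDerivAt_lswLift`,
  `hasDerivAt_lswLiftD` (chain/product rule where `sin(θ/4) > 0`) and **`lswOp_lswLift`**
  (`(κ/2)(LQ)'' + cot(θ/2)(LQ)' - L(MQ) = 0` on `(0, 2π)`); boundary lemmas `lswLift_zero_left`,
  `lswLiftD_two_pi`, `lswLift_four_pi_sub`, bounds;
* `lswEigenfun κ n` (`φ_n`), `lswEigenfunD`, `lswEigenfunDD`, **`lswOp_lswEigenfun`**, the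
  time-dependent form `lswOp_exp_lswEigenfun`, `lswEigenfun_zero_eq_lswH`, boundary behaviour.

## References

* G. F. Lawler, O. Schramm, W. Werner, *One-arm exponent for critical 2D percolation*, Electron.
  J. Probab. 7 (2002), no. 2: (1.1), Lemma 2.2, (2.3), (2.4), (2.11), (2.12), p. 7 (`H`).
  [LawlerSchrammWernerEJP2002]
* G. E. Andrews, R. Askey, R. Roy, *Special Functions*, CUP (1999): (2.3.5), Def. 2.5.1.
  [AndrewsAskeyRoy1999]
-/

noncomputable section

open Real Set Filter Polynomial
open scoped Topology

namespace Literature.Probability.Percolation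

open Literature.Analysis.SpecialFunctions
open Literature.Probability.RandomPlanarGeometry.RadialLoewner (hasDerivAt_sin_div
  hasDerivAt_cos_div hasDerivAt_sinPow hasDerivAt_deriv_sinPow)

/-! ### Parameters -/

/-- The third hypergeometric parameter `c = 3/2 - 2/κ` of the eigenvalue problem for
`Λ = (κ/2) ∂² + cot(θ/2) ∂` in the variable `z = sin²(θ/4)` (Dirichlet branch at `z = 0`).
[folklore] -/
def lswJacobiParam (κ : ℝ) : ℝ := 3 / 2 - 2 / κ

/-- The `n`-th eigenvalue `λ_n = λ + (κ/8) n (n + 1)` of `-Λ` with Dirichlet condition at `0` and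
reflection at `2π`; `λ_0 = λ = (κ² - 16)/(32κ)` is LSW's exponent (1.1).
[cite: LawlerSchrammWernerEJP2002, (1.1)] -/
def lswEigenvalue (κ : ℝ) (n : ℕ) : ℝ := lswLambda κ + κ / 8 * n * (n + 1)

/-- `c > 1` for `κ > 4`. [folklore] -/
theorem one_lt_lswJacobiParam {κ : ℝ} (hκ : 4 < κ) : 1 < lswJacobiParam κ := by
  unfold lswJacobiParam
  have : 2 / κ < 1 / 2 := by rw [div_lt_iff₀ (by linarith)]; linarith
  linarith

/-- `c < 3/2 < 2` for `κ > 0`. [folklore] -/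
theorem lswJacobiParam_lt_two {κ : ℝ} (hκ : 0 < κ) : lswJacobiParam κ < 2 := by
  unfold lswJacobiParam
  have : 0 < 2 / κ := by positivity
  linarith

/-- `k + c ≠ 0` for every `k ∈ ℕ` when `κ > 4` (so the hypergeometric equation applies).
[folklore] -/
theorem natCast_add_lswJacobiParam_ne_zero {κ : ℝ} (hκ : 4 < κ) (k : ℕ) :
    (k : ℝ) + lswJacobiParam κ ≠ 0 := by
  have := one_lt_lswJacobiParam hκ
  positivity

/-- `λ_0 = λ`. [folklore] -/
@[simp] theorem lswEigenvalue_zero (κ : ℝ) : lswEigenvalue κ 0 = lswLambda κ := by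
  simp [lswEigenvalue]

/-- `λ ≤ λ_n` (`κ ≥ 0`). [folklore] -/
theorem lswLambda_le_lswEigenvalue {κ : ℝ} (hκ : 0 ≤ κ) (n : ℕ) :
    lswLambda κ ≤ lswEigenvalue κ n := by
  unfold lswEigenvalue
  have : 0 ≤ κ / 8 * n * (n + 1) := by positivity
  linarith

/-- `λ_n > 0` for `κ > 4`. [folklore] -/
theorem lswEigenvalue_pos {κ : ℝ} (hκ : 4 < κ) (n : ℕ) : 0 < lswEigenvalue κ n :=
  (lswLambda_pos hκ).trans_le (lswLambda_le_lswEigenvalue (by linarith) n)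

/-- The eigenvalues grow at least quadratically: `(κ/8) n² ≤ λ_n` (`κ > 4`). [folklore] -/
theorem lswEigenvalue_ge {κ : ℝ} (hκ : 4 < κ) (n : ℕ) :
    κ / 8 * (n : ℝ) ^ 2 ≤ lswEigenvalue κ n := by
  unfold lswEigenvalue
  have h1 := (lswLambda_pos hκ).le
  have h2 : κ / 8 * (n : ℝ) ^ 2 ≤ κ / 8 * n * (n + 1) := by
    have : (0 : ℝ) ≤ κ / 8 * n := by positivity
    nlinarith
  linarith

/-! ### The Dirichlet-branch lift and its calculus -/

section Lift

variable (κ : ℝ) (Q Q₁ Q₂ : ℝ → ℝ)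

/-- **The lift** `(L Q)(θ) = sin(θ/4)^q · Q(sin²(θ/4))`, `q = (κ-4)/κ`, of a function of
`z ∈ [0, 1]` to a function of `θ` carrying the Dirichlet branch of `Λ` at `θ = 0`. [folklore] -/
def lswLift (θ : ℝ) : ℝ := Real.sin (θ / 4) ^ lswQ κ * Q (Real.sin (θ / 4) ^ 2)

/-- The derivative `(L Q)'` as an explicit function of `θ`, given `Q' = Q₁` (product and chain
rule, `d/dθ sin²(θ/4) = sin(θ/4) cos(θ/4)/2`; valid where `sin(θ/4) > 0`). [folklore] -/
def lswLiftD (θ : ℝ) : ℝ :=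
  lswQ κ * Real.sin (θ / 4) ^ lswQ κ * Real.cos (θ / 4) / (4 * Real.sin (θ / 4))
      * Q (Real.sin (θ / 4) ^ 2)
    + Real.sin (θ / 4) ^ lswQ κ * Q₁ (Real.sin (θ / 4) ^ 2)
      * (Real.sin (θ / 4) * Real.cos (θ / 4) / 2)

/-- The second derivative `(L Q)''` as an explicit function of `θ`, given `Q' = Q₁`, `Q₁' = Q₂`
(valid where `sin(θ/4) > 0`). [folklore] -/
def lswLiftDD (θ : ℝ) : ℝ :=
  lswQ κ * Real.sin (θ / 4) ^ lswQ κ * (lswQ κ * (1 - Real.sin (θ / 4) ^ 2) - 1)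
      / (16 * Real.sin (θ / 4) ^ 2) * Q (Real.sin (θ / 4) ^ 2)
    + lswQ κ * Real.sin (θ / 4) ^ lswQ κ * Real.cos (θ / 4) ^ 2 / 4 * Q₁ (Real.sin (θ / 4) ^ 2)
    + Real.sin (θ / 4) ^ lswQ κ * Q₂ (Real.sin (θ / 4) ^ 2)
      * (Real.sin (θ / 4) ^ 2 * Real.cos (θ / 4) ^ 2 / 4)
    + Real.sin (θ / 4) ^ lswQ κ * Q₁ (Real.sin (θ / 4) ^ 2)
      * ((1 - 2 * Real.sin (θ / 4) ^ 2) / 8)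

/-- **The conjugated operator, lifted**: `L(M Q)` with
`M Q = (κ/8)[z(1-z) Q'' + (c - 2z) Q'] - λ Q`, `c = 3/2 - 2/κ`, `λ = lswLambda κ`; by `lswOp_lswLift`
this is `Λ (L Q)`, so for a solution `Y` of `∂ₜ Y = M Y` the lift `L Y` solves LSW's PDE (2.4).
[folklore] -/
def lswLiftT (θ : ℝ) : ℝ :=
  Real.sin (θ / 4) ^ lswQ κ *
    (κ / 8 * (Real.sin (θ / 4) ^ 2 * (1 - Real.sin (θ / 4) ^ 2) * Q₂ (Real.sin (θ / 4) ^ 2)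
        + (lswJacobiParam κ - 2 * Real.sin (θ / 4) ^ 2) * Q₁ (Real.sin (θ / 4) ^ 2))
      - lswLambda κ * Q (Real.sin (θ / 4) ^ 2))

variable {κ Q Q₁ Q₂}

/-- `d/dθ sin²(θ/4) = sin(θ/4) cos(θ/4) / 2`. [folklore] -/
theorem hasDerivAt_sin_quarter_sq (θ : ℝ) :
    HasDerivAt (fun y : ℝ => Real.sin (y / 4) ^ 2) (Real.sin (θ / 4) * Real.cos (θ / 4) / 2)
      θ := by
  refine ((hasDerivAt_sin_div 4 θ).pow 2).congr_deriv ?_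
  simp only [Nat.cast_ofNat, Nat.add_one_sub_one, pow_one]
  ring

/-- **`(L Q)' = lswLiftD`** where `sin(θ/4) > 0`, if `Q` has derivative `Q₁` at `sin²(θ/4)`.
[folklore] -/
theorem hasDerivAt_lswLift {θ : ℝ} (hs : 0 < Real.sin (θ / 4))
    (hQ : HasDerivAt Q (Q₁ (Real.sin (θ / 4) ^ 2)) (Real.sin (θ / 4) ^ 2)) :
    HasDerivAt (lswLift κ Q) (lswLiftD κ Q Q₁ θ) θ := by
  have hS := hasDerivAt_sinPow (m := 4) (q := lswQ κ) hs
  have hP := hQ.comp θ (hasDerivAt_sin_quarter_sq θ)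
  exact (hS.mul hP).congr_deriv (by unfold lswLiftD; simp only [Function.comp_def]; ring)

/-- **`(L Q)'' = lswLiftDD`** where `sin(θ/4) > 0`, if `Q' = Q₁` and `Q₁' = Q₂` at `sin²(θ/4)`.
[folklore] -/
theorem hasDerivAt_lswLiftD {θ : ℝ} (hs : 0 < Real.sin (θ / 4))
    (hQ : HasDerivAt Q (Q₁ (Real.sin (θ / 4) ^ 2)) (Real.sin (θ / 4) ^ 2))
    (hQ₁ : HasDerivAt Q₁ (Q₂ (Real.sin (θ / 4) ^ 2)) (Real.sin (θ / 4) ^ 2)) :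
    HasDerivAt (lswLiftD κ Q Q₁) (lswLiftDD κ Q Q₁ Q₂ θ) θ := by
  have hS := hasDerivAt_sinPow (m := 4) (q := lswQ κ) hs
  have hA := hasDerivAt_deriv_sinPow (m := 4) (q := lswQ κ) (by norm_num) hs
  have hz := hasDerivAt_sin_quarter_sq θ
  have hP := hQ.comp θ hz
  have hP1 := hQ₁.comp θ hz
  have hB : HasDerivAt (fun y : ℝ => Real.sin (y / 4) * Real.cos (y / 4) / 2)
      ((1 - 2 * Real.sin (θ / 4) ^ 2) / 8) θ := by
    refine (((hasDerivAt_sin_div 4 θ).mul (hasDerivAt_cos_div 4 θ)).div_const 2).congr_deriv ?_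
    linear_combination (1 / 8 : ℝ) * Real.sin_sq_add_cos_sq (θ / 4)
  have hA' : HasDerivAt
      (fun y : ℝ => lswQ κ * Real.sin (y / 4) ^ lswQ κ * Real.cos (y / 4) / (4 * Real.sin (y / 4)))
      (lswQ κ * Real.sin (θ / 4) ^ lswQ κ * (lswQ κ * (1 - Real.sin (θ / 4) ^ 2) - 1)
        / (4 ^ 2 * Real.sin (θ / 4) ^ 2)) θ :=
    hA.congr_deriv (by rw [Real.cos_sq'])
  have h := (hA'.mul hP).add ((hS.mul hP1).mul hB)
  have hs0 : Real.sin (θ / 4) ≠ 0 := hs.ne'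
  refine h.congr_deriv ?_
  simp only [lswLiftDD, Pi.mul_apply, Function.comp_apply]
  field_simp
  ring

/-- **`Λ (L Q) = L (M Q)` on `(0, 2π)`**: with the explicit first and second derivatives,
`(κ/2) (LQ)'' + cot(θ/2) (LQ)' - L(MQ) = 0`, i.e. `lswOp κ θ (LQ)'' (LQ)' (L(MQ)) = 0`. Pure
algebra: `cot(θ/2) = (1 - 2 sin²(θ/4)) / (2 sin(θ/4) cos(θ/4))`, `κ q = κ - 4`, `32 λ = q(κ + 4)`,
`2κ c = 3κ - 4`. [folklore] -/
theorem lswOp_lswLift (hκ : κ ≠ 0) {θ : ℝ} (hθ : θ ∈ Ioo 0 (2 * π)) :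
    lswOp κ θ (lswLiftDD κ Q Q₁ Q₂ θ) (lswLiftD κ Q Q₁ θ) (lswLiftT κ Q Q₁ Q₂ θ) = 0 := by
  have hs : 0 < Real.sin (θ / 4) := sin_quarter_pos hθ.1 hθ.2.le
  have hc : 0 < Real.cos (θ / 4) := cos_quarter_pos hθ.1.le hθ.2
  have hcot : Real.cot (θ / 2) =
      (1 - 2 * Real.sin (θ / 4) ^ 2) / (2 * Real.sin (θ / 4) * Real.cos (θ / 4)) := by
    rw [Real.cot_eq_cos_div_sin, show θ / 2 = 2 * (θ / 4) by ring, Real.cos_two_mul,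
      Real.sin_two_mul, Real.cos_sq']
    ring_nf
  unfold lswOp lswLiftDD lswLiftD lswLiftT
  simp only [Real.cos_sq']
  rw [hcot]
  set S := Real.sin (θ / 4) ^ lswQ κ with hS
  set P := Q (Real.sin (θ / 4) ^ 2) with hP
  set P1 := Q₁ (Real.sin (θ / 4) ^ 2) with hP1
  set P2 := Q₂ (Real.sin (θ / 4) ^ 2) with hP2
  set s := Real.sin (θ / 4) with hs'
  set co := Real.cos (θ / 4) with hco
  have hs0 : s ≠ 0 := hs.ne'
  have hc0 : co ≠ 0 := hc.ne'
  unfold lswQ lswLambda lswJacobiParam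
  field_simp
  ring

/-- `(L Q)(0) = 0` (`κ > 4`): the Dirichlet condition (2.3) at `θ = 0`.
[cite: LawlerSchrammWernerEJP2002, (2.3)] -/
theorem lswLift_zero_left (hκ : 4 < κ) : lswLift κ Q 0 = 0 := by
  rw [lswLift, zero_div, Real.sin_zero, Real.zero_rpow (lswQ_pos hκ).ne', zero_mul]

/-- `(L Q)'(2π) = 0`: the reflecting (Neumann) condition at `θ = 2π` (`cos(π/2) = 0`),
cf. (2.12). [cite: LawlerSchrammWernerEJP2002, Lemma 2.3, (2.12)] -/
theorem lswLiftD_two_pi : lswLiftD κ Q Q₁ (2 * π) = 0 := by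
  unfold lswLiftD
  rw [show 2 * π / 4 = π / 2 by ring, Real.cos_pi_div_two]
  ring

/-- `(L Q)(2π) = Q(1)` (`sin(π/2) = 1`). [folklore] -/
theorem lswLift_two_pi : lswLift κ Q (2 * π) = Q 1 := by
  rw [lswLift, show 2 * π / 4 = π / 2 by ring, Real.sin_pi_div_two, Real.one_rpow, one_pow,
    one_mul]

/-- **Evenness about `2π`**: `(L Q)(4π - θ) = (L Q)(θ)` (`sin(π - x) = sin x`), the symmetry
behind the reflecting boundary condition at `2π`. [folklore] -/
theorem lswLift_four_pi_sub (θ : ℝ) : lswLift κ Q (4 * π - θ) = lswLift κ Q θ := by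
  unfold lswLift
  rw [show (4 * π - θ) / 4 = π - θ / 4 by ring, Real.sin_pi_sub]

/-- `(L Q)'` is odd about `2π`. [folklore] -/
theorem lswLiftD_four_pi_sub (θ : ℝ) : lswLiftD κ Q Q₁ (4 * π - θ) = -lswLiftD κ Q Q₁ θ := by
  unfold lswLiftD
  rw [show (4 * π - θ) / 4 = π - θ / 4 by ring, Real.sin_pi_sub, Real.cos_pi_sub]
  ring

/-- `L Q` is continuous if `Q` is (`κ > 4`, so `q > 0`). [folklore] -/
theorem continuous_lswLift (hκ : 4 < κ) (hQ : Continuous Q) : Continuous (lswLift κ Q) := by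
  unfold lswLift
  refine ((Real.continuous_sin.comp (continuous_id.div_const _)).rpow_const fun _ =>
    Or.inr (lswQ_pos hκ).le).mul ?_
  exact hQ.comp ((Real.continuous_sin.comp (continuous_id.div_const _)).pow 2)

/-- `|(L Q)(θ)| ≤ sin(θ/4)^q · M` on `[0, 2π]` if `|Q| ≤ M` on `[0, 1]`; in particular
`L Q → 0` as `θ → 0⁺` at rate `θ^q`. [folklore] -/
theorem abs_lswLift_le {M : ℝ} (hM : ∀ z ∈ Icc (0 : ℝ) 1, |Q z| ≤ M) {θ : ℝ}
    (hθ : θ ∈ Icc 0 (2 * π)) : |lswLift κ Q θ| ≤ Real.sin (θ / 4) ^ lswQ κ * M := by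
  have hs0 : 0 ≤ Real.sin (θ / 4) :=
    Real.sin_nonneg_of_nonneg_of_le_pi (by linarith [hθ.1]) (by linarith [hθ.2, Real.pi_pos])
  have h0 : 0 ≤ Real.sin (θ / 4) ^ lswQ κ := Real.rpow_nonneg hs0 _
  have hz : Real.sin (θ / 4) ^ 2 ∈ Icc (0 : ℝ) 1 :=
    ⟨by positivity, by nlinarith [Real.sin_le_one (θ / 4)]⟩
  rw [lswLift, abs_mul, abs_of_nonneg h0]
  exact mul_le_mul_of_nonneg_left (hM _ hz) h0

/-- `|(L Q)(θ)| ≤ M` on `[0, 2π]` if `|Q| ≤ M` on `[0, 1]` (`0 ≤ sin(θ/4)^q ≤ 1`). [folklore] -/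
theorem abs_lswLift_le' (hκ : 4 < κ) {M : ℝ} (hM0 : 0 ≤ M) (hM : ∀ z ∈ Icc (0 : ℝ) 1, |Q z| ≤ M)
    {θ : ℝ} (hθ : θ ∈ Icc 0 (2 * π)) : |lswLift κ Q θ| ≤ M := by
  refine (abs_lswLift_le hM hθ).trans ?_
  have hs0 : 0 ≤ Real.sin (θ / 4) :=
    Real.sin_nonneg_of_nonneg_of_le_pi (by linarith [hθ.1]) (by linarith [hθ.2, Real.pi_pos])
  have h1 : Real.sin (θ / 4) ^ lswQ κ ≤ 1 :=
    Real.rpow_le_one hs0 (Real.sin_le_one _) (lswQ_pos hκ).le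
  nlinarith

end Lift

/-! ### The eigenfunctions -/

/-- **The `n`-th eigenfunction** `φ_n(θ) = sin(θ/4)^q · ₂F₁(-n, n+1; c; sin²(θ/4))`,
`q = (κ-4)/κ`, `c = 3/2 - 2/κ`, of `Λ = (κ/2)∂² + cot(θ/2)∂` with `φ_n(0) = 0`, `φ_n'(2π) = 0`;
`φ_0 = sin(θ/4)^q` is LSW's `H(·, 0)`. [cite: LawlerSchrammWernerEJP2002, Lemma 2.2 and p. 7] -/
def lswEigenfun (κ : ℝ) (n : ℕ) : ℝ → ℝ :=
  lswLift κ fun z => (hypJacobi (lswJacobiParam κ) n).eval z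

/-- `φ_n'` (explicit; valid where `sin(θ/4) > 0`). [folklore] -/
def lswEigenfunD (κ : ℝ) (n : ℕ) : ℝ → ℝ :=
  lswLiftD κ (fun z => (hypJacobi (lswJacobiParam κ) n).eval z)
    fun z => (derivative (hypJacobi (lswJacobiParam κ) n)).eval z

/-- `φ_n''` (explicit; valid where `sin(θ/4) > 0`). [folklore] -/
def lswEigenfunDD (κ : ℝ) (n : ℕ) : ℝ → ℝ :=
  lswLiftDD κ (fun z => (hypJacobi (lswJacobiParam κ) n).eval z)
    (fun z => (derivative (hypJacobi (lswJacobiParam κ) n)).eval z)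
    fun z => (derivative (derivative (hypJacobi (lswJacobiParam κ) n))).eval z

/-- `φ_0(θ) = sin(θ/4)^q`. [folklore] -/
theorem lswEigenfun_zero (κ θ : ℝ) : lswEigenfun κ 0 θ = Real.sin (θ / 4) ^ lswQ κ := by
  simp [lswEigenfun, lswLift]

/-- `φ_0 = H(·, 0)` (the tree's `lswH`). [folklore] -/
theorem lswEigenfun_zero_eq_lswH (κ θ : ℝ) : lswEigenfun κ 0 θ = lswH κ θ 0 := by
  rw [lswEigenfun_zero, lswH, mul_zero, neg_zero, Real.exp_zero, mul_one]

/-- **`φ_n' = lswEigenfunD`** where `sin(θ/4) > 0`. [folklore] -/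
theorem hasDerivAt_lswEigenfun (κ : ℝ) (n : ℕ) {θ : ℝ} (hs : 0 < Real.sin (θ / 4)) :
    HasDerivAt (lswEigenfun κ n) (lswEigenfunD κ n θ) θ :=
  hasDerivAt_lswLift hs (hasDerivAt_hypJacobi_eval _ n _)

/-- **`φ_n'' = lswEigenfunDD`** where `sin(θ/4) > 0`. [folklore] -/
theorem hasDerivAt_lswEigenfunD (κ : ℝ) (n : ℕ) {θ : ℝ} (hs : 0 < Real.sin (θ / 4)) :
    HasDerivAt (lswEigenfunD κ n) (lswEigenfunDD κ n θ) θ :=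
  hasDerivAt_lswLiftD hs (hasDerivAt_hypJacobi_eval _ n _)
    (hasDerivAt_derivative_hypJacobi_eval _ n _)

/-- `M y_n = -λ_n y_n`, lifted: `L(M y_n) = -λ_n φ_n` (Euler's equation for `y_n`; `κ > 4`).
[folklore] -/
theorem lswLiftT_hypJacobi {κ : ℝ} (hκ : 4 < κ) (n : ℕ) (θ : ℝ) :
    lswLiftT κ (fun z => (hypJacobi (lswJacobiParam κ) n).eval z)
        (fun z => (derivative (hypJacobi (lswJacobiParam κ) n)).eval z)
        (fun z => (derivative (derivative (hypJacobi (lswJacobiParam κ) n))).eval z) θ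
      = -(lswEigenvalue κ n * lswEigenfun κ n θ) := by
  have hode := hypJacobi_ode_eval n (c := lswJacobiParam κ)
    (fun k _ => natCast_add_lswJacobiParam_ne_zero hκ k) (Real.sin (θ / 4) ^ 2)
  unfold lswLiftT lswEigenfun lswLift lswEigenvalue
  linear_combination (κ / 8 * Real.sin (θ / 4) ^ lswQ κ) * hode

/-- **`Λ φ_n = -λ_n φ_n` on `(0, 2π)`** (`κ > 4`): `(κ/2) φ_n'' + cot(θ/2) φ_n' + λ_n φ_n = 0`,
i.e. `lswOp κ θ φ_n'' φ_n' (-λ_n φ_n) = 0` in the tree's notation — LSW's "`Λ H = 0`" (p. 7) for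
the whole spectrum of the Dirichlet-at-`0` / Neumann-at-`2π` problem of Lemma 2.2, (2.3), (2.12).
[cite: LawlerSchrammWernerEJP2002, Lemma 2.2, (2.4) and p. 7] -/
theorem lswOp_lswEigenfun {κ : ℝ} (hκ : 4 < κ) (n : ℕ) {θ : ℝ} (hθ : θ ∈ Ioo 0 (2 * π)) :
    lswOp κ θ (lswEigenfunDD κ n θ) (lswEigenfunD κ n θ)
      (-(lswEigenvalue κ n * lswEigenfun κ n θ)) = 0 := by
  rw [← lswLiftT_hypJacobi hκ n θ]
  exact lswOp_lswLift (by linarith) hθ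

/-- **The separated solutions of LSW's PDE (2.4)**: for `κ > 4`, every `n` and every `t`, the
function `e^{-λ_n t} φ_n(θ)` satisfies `(κ/2) ∂²_θ + cot(θ/2) ∂_θ - ∂ₜ = 0` on `(0, 2π)`, with
`θ`-derivatives `e^{-λ_n t} φ_n'`, `e^{-λ_n t} φ_n''` and `t`-derivative `-λ_n e^{-λ_n t} φ_n`.
[cite: LawlerSchrammWernerEJP2002, Lemma 2.2, (2.4)] -/
theorem lswOp_exp_lswEigenfun {κ : ℝ} (hκ : 4 < κ) (n : ℕ) {θ : ℝ} (hθ : θ ∈ Ioo 0 (2 * π))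
    (t : ℝ) :
    lswOp κ θ (Real.exp (-(lswEigenvalue κ n * t)) * lswEigenfunDD κ n θ)
      (Real.exp (-(lswEigenvalue κ n * t)) * lswEigenfunD κ n θ)
      (Real.exp (-(lswEigenvalue κ n * t)) * -(lswEigenvalue κ n * lswEigenfun κ n θ)) = 0 := by
  rw [lswOp_smul, lswOp_lswEigenfun hκ n hθ, mul_zero]

/-- The `t`-derivative of `e^{-λ_n t} φ_n(θ)` is `e^{-λ_n t} · (-λ_n φ_n(θ))`. [folklore] -/
theorem hasDerivAt_exp_lswEigenfun_t (κ : ℝ) (n : ℕ) (θ t : ℝ) :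
    HasDerivAt (fun s => Real.exp (-(lswEigenvalue κ n * s)) * lswEigenfun κ n θ)
      (Real.exp (-(lswEigenvalue κ n * t)) * -(lswEigenvalue κ n * lswEigenfun κ n θ)) t := by
  have h1 : HasDerivAt (fun s : ℝ => -(lswEigenvalue κ n * s)) (-lswEigenvalue κ n) t :=
    (((hasDerivAt_id t).const_mul (lswEigenvalue κ n)).neg).congr_deriv (by simp)
  exact (h1.exp.mul_const (lswEigenfun κ n θ)).congr_deriv (by ring)

/-! ### Boundary behaviour of the eigenfunctions -/

/-- `φ_n(0) = 0` (`κ > 4`): the Dirichlet condition (2.3).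
[cite: LawlerSchrammWernerEJP2002, (2.3)] -/
theorem lswEigenfun_zero_left {κ : ℝ} (hκ : 4 < κ) (n : ℕ) : lswEigenfun κ n 0 = 0 :=
  lswLift_zero_left hκ

/-- `φ_n'(2π) = 0`: the reflecting (Neumann) condition at `θ = 2π`, cf. (2.12).
[cite: LawlerSchrammWernerEJP2002, Lemma 2.3, (2.12)] -/
theorem lswEigenfunD_two_pi (κ : ℝ) (n : ℕ) : lswEigenfunD κ n (2 * π) = 0 :=
  lswLiftD_two_pi

/-- `φ_n(2π) = y_n(1)`. [folklore] -/
theorem lswEigenfun_two_pi (κ : ℝ) (n : ℕ) :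
    lswEigenfun κ n (2 * π) = (hypJacobi (lswJacobiParam κ) n).eval 1 :=
  lswLift_two_pi

/-- `φ_n` is even about `2π`. [folklore] -/
theorem lswEigenfun_four_pi_sub (κ : ℝ) (n : ℕ) (θ : ℝ) :
    lswEigenfun κ n (4 * π - θ) = lswEigenfun κ n θ :=
  lswLift_four_pi_sub θ

/-- `φ_n` is continuous on `ℝ` (`κ > 4`). [folklore] -/
theorem continuous_lswEigenfun {κ : ℝ} (hκ : 4 < κ) (n : ℕ) : Continuous (lswEigenfun κ n) :=
  continuous_lswLift hκ (continuous_hypJacobi_eval _ n)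

/-- `|φ_n| ≤ M_n` on `[0, 2π]` for some constant. [folklore] -/
theorem exists_bound_lswEigenfun {κ : ℝ} (hκ : 4 < κ) (n : ℕ) :
    ∃ M : ℝ, 0 ≤ M ∧ ∀ θ ∈ Icc 0 (2 * π), |lswEigenfun κ n θ| ≤ M := by
  obtain ⟨M, hM0, hM⟩ :=
    exists_bound_polynomial_eval_unitInterval (hypJacobi (lswJacobiParam κ) n)
  exact ⟨M, hM0, fun θ hθ => abs_lswLift_le' hκ hM0 hM hθ⟩

end Literature.Probability.Percolation
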